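import Literature.Computability.QuantumComplexity.CoreDescUniform
import Literature.Computability.Complexity.CodeFPArithExpr
import Literature.Computability.Cryptography.QuantumCircuitDescFP
import Summits.QuantumAdvantage.QuantumAdvantage.Theorems.SymplecticPurityDefs

/-!
# Route `SymplecticPurity`, item `NoFreeFrame` — the witness family is polynomial-time uniform

`cubeFamily.IsUniform` (and `IsOracleFree`): the description `sigmaEncode ⟨n, n, cubeCirc n⟩` is
computed from `1ⁿ` in the typed `FP` algebra `CodeFP` (Arora–Barak 2009 §6.2, as set up in the tree by
`QuantumCircuitDescFP.lean`, `CodeFP*.lean` and the abstract-gate layer of `CoreDescAbstract.lean` /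
`CoreDescBlockFP.lean`): the exponent lists `cubeExps` are fixed arithmetic expressions (`AExp`), the
program `cubeOpsA n` is two nested `flatMap`s over `[0, …, n-1]`, its compiled Clifford+T word is the
abstract program `progA`, and the Hadamard layer is `hLayerA (range n)`.
-/

noncomputable section

set_option linter.dupNamespace false -- D-0017: single-problem summit ⇒ `QuantumAdvantage.QuantumAdvantage` by design

namespace Summit.QuantumAdvantage.QuantumAdvantage.Theorems.SymplecticPurity

open Literature.Computability.QuantumComplexity Literature.Computability.Cryptography
open Literature.Computability.Complexity Literature.Computability.Complexity.CodeFP AJLCore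
open _root_.Computability

/-! ### The exponent lists in `FP` -/

/-- The environment `([h, m], [])` of the exponent expressions. -/
theorem cubeEnv_fp : CodeFP (pairE natE natE) aenvE (fun p => ([p.1, p.2], ([] : List (List ℕ)))) :=
  codeFP_mkEnv (natList2 (fst _ _) (snd _ _)) (const _ [])

/-- **`(h, m) ↦ cubeExps h m` in `FP`.** -/
theorem cubeExps_fp : CodeFP (pairE natE natE) (rawE natE) (fun p => cubeExps p.1 p.2) := by
  have hE := cubeEnv_fp
  have h0 : CodeFP (pairE natE natE) bitE (fun p => (AExp.beq (.var 0) (.lit 0)).flag ([p.1, p.2], [])) :=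
    codeFP_flag' hE _
  have hlt : CodeFP (pairE natE natE) bitE
      (fun p => (AExp.lt (AExp.emod (.var 1) (.mul (.lit 3) (.var 0))) (.mul (.lit 2) (.var 0))).flag ([p.1, p.2], [])) := codeFP_flag' hE _
  have h1 : CodeFP (pairE natE natE) (rawE natE) (fun p => [(AExp.emod (.var 1) (.mul (.lit 3) (.var 0)))].map (AExp.eval ([p.1, p.2], []))) :=
    codeFP_evalList' hE _
  have h2 : CodeFP (pairE natE natE) (rawE natE)
      (fun p => [AExp.sub (AExp.emod (.var 1) (.mul (.lit 3) (.var 0))) (.var 0), AExp.sub (AExp.emod (.var 1) (.mul (.lit 3) (.var 0))) (.mul (.lit 2) (.var 0))].map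
        (AExp.eval ([p.1, p.2], []))) := codeFP_evalList' hE _
  refine ((h0.ite (const _ []) (hlt.ite h1 h2)).congr fun p => ?_)
  obtain ⟨h, m⟩ := p
  simp only [AExp.flag_beq, AExp.flag_lt, AExp.eval, List.map_cons, List.map_nil,
    List.getD_cons_zero, List.getD_cons_succ, decide_eq_true_eq, cubeExps]


/-! ### The program `cubeOpsA` in `FP` -/

/-- Binary value of the unary first component. -/
theorem unFst_toNat {β : Type} {eβ : β → List Bool} : CodeFP (pairE unE eβ) natE (fun p => p.1) :=
  (natOfUn.comp (fst _ _)).congr fun _ => rfl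

/-- The linear chunk of input wire `i`: `(1ⁿ, i) ↦ [CNOT i (n + l) | l ∈ cubeExps (n/2) (3i)]`. -/
theorem cubeLinChunk_fp : CodeFP (pairE unE natE) (rawE clopE)
    (fun p => (cubeExps (p.1 / 2) (3 * p.2)).map fun l => ClOp.cnot p.2 (p.1 + l)) := by
  have hinner : CodeFP (pairE (pairE unE natE) natE) clopE
      (fun t => ClOp.cnot t.1.2 (t.1.1 + t.2)) :=
    clop_cnot (fst _ _).snd' (natAdd.comp ((unFst_toNat.comp (fst _ _)).pair (snd _ _)))
  have hexps : CodeFP (pairE unE natE) (rawE natE) (fun p => cubeExps (p.1 / 2) (3 * p.2)) :=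
    cubeExps_fp.comp ((natDiv.comp (unFst_toNat.pair (const _ 2))).pair (natMul.comp ((const _ 3).pair (snd _ _))))
  exact ((map hinner).comp ((CodeFP.id _).pair hexps)).congr fun _ => rfl

/-- **`1ⁿ ↦ cubeLinOps n` in `FP`.** -/
theorem cubeLinOps_fp : CodeFP unE (rawE clopE) cubeLinOps := by
  have h := (map (σ := ℕ) (eσ := unE) cubeLinChunk_fp).comp ((CodeFP.id _).pair urange)
  exact ((flatten clopE).comp h).congr fun n => by
    rw [cubeLinOps, List.flatMap_def]; rfl

/-- The quadratic chunk of a pair of input wires: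
`((1ⁿ, i), j) ↦ if i = j then [] else [TOF i j (n + l) | l ∈ cubeExps (n/2) (i + 2j)]`. -/
theorem cubeQuadChunk_fp : CodeFP (pairE (pairE unE natE) natE) (rawE clopE)
    (fun t => if t.1.2 = t.2 then [] else
      (cubeExps (t.1.1 / 2) (t.1.2 + 2 * t.2)).map fun l => ClOp.toffoli t.1.2 t.2 (t.1.1 + l)) := by
  have hinner : CodeFP (pairE (pairE (pairE unE natE) natE) natE) clopE
      (fun u => ClOp.toffoli u.1.1.2 u.1.2 (u.1.1.1 + u.2)) :=
    clop_toffoli (fst _ _).fst'.snd' (fst _ _).snd'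
      (natAdd.comp ((unFst_toNat.comp (fst _ _).fst').pair (snd _ _)))
  have hexps : CodeFP (pairE (pairE unE natE) natE) (rawE natE)
      (fun t => cubeExps (t.1.1 / 2) (t.1.2 + 2 * t.2)) :=
    cubeExps_fp.comp ((natDiv.comp ((unFst_toNat.comp (fst _ _)).pair (const _ 2))).pair
      (natAdd.comp ((fst _ _).snd'.pair (natMul.comp ((const _ 2).pair (snd _ _))))))
  have hlist : CodeFP (pairE (pairE unE natE) natE) (rawE clopE)
      (fun t => (cubeExps (t.1.1 / 2) (t.1.2 + 2 * t.2)).map fun l => ClOp.toffoli t.1.2 t.2 (t.1.1 + l)) :=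
    ((map hinner).comp ((CodeFP.id _).pair hexps)).congr fun _ => rfl
  have heq : CodeFP (pairE (pairE unE natE) natE) bitE (fun t => decide (t.1.2 = t.2)) :=
    natEq.comp ((fst _ _).snd'.pair (snd _ _))
  exact (heq.ite (const _ []) hlist).congr fun t => by
    by_cases h : t.1.2 = t.2 <;> simp [h]

/-- The quadratic chunks of input wire `i`: `(1ⁿ, i) ↦ flatMap over j < n`. -/
theorem cubeQuadRow_fp : CodeFP (pairE unE natE) (rawE clopE)
    (fun p => (List.range p.1).flatMap fun j => if p.2 = j then [] else
      (cubeExps (p.1 / 2) (p.2 + 2 * j)).map fun l => ClOp.toffoli p.2 j (p.1 + l)) := by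
  have hrange : CodeFP (pairE unE natE) (rawE natE) (fun p => List.range p.1) := urange.comp (fst _ _)
  have h := (map cubeQuadChunk_fp).comp ((CodeFP.id _).pair hrange)
  exact ((flatten clopE).comp h).congr fun p => by rw [List.flatMap_def]; rfl

/-- **`1ⁿ ↦ cubeQuadOps n` in `FP`.** -/
theorem cubeQuadOps_fp : CodeFP unE (rawE clopE) cubeQuadOps := by
  have h := (map (σ := ℕ) (eσ := unE) cubeQuadRow_fp).comp ((CodeFP.id _).pair urange)
  exact ((flatten clopE).comp h).congr fun n => by
    rw [cubeQuadOps, List.flatMap_def]; rfl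

/-- **`1ⁿ ↦ cubeOpsA n` in `FP`.** -/
theorem cubeOpsA_fp : CodeFP unE (rawE clopE) cubeOpsA :=
  (clopAppend cubeLinOps_fp cubeQuadOps_fp).congr fun _ => rfl

/-- `1ⁿ ↦` the program with wires reduced mod `n + n` (the values of the `Fin`-transport). -/
theorem cubeOpsMod_fp : CodeFP unE (rawE clopE) (fun n => (cubeOpsA n).map (ClOp.map fun v => v % (n + n))) := by
  have hmod : CodeFP (pairE unE natE) natE (fun p => p.2 % (p.1 + p.1)) :=
    natMod.comp ((snd _ _).pair (natAdd.comp (unFst_toNat.pair unFst_toNat)))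
  have hop : CodeFP (pairE unE clopE) clopE (fun p => p.2.map fun v => v % (p.1 + p.1)) := by
    have hT : CodeFP (pairE unE clopE) ctE (fun t => clopTuple t.2) :=
      (transparent (eα := clopE) (eβ := ctE) (g := clopTuple) fun _ => rfl).comp (snd _ _)
    have hm : CodeFP (pairE (pairE unE clopE) natE) natE (fun q => q.2 % (q.1.1 + q.1.1)) :=
      hmod.comp ((fst _ _).fst'.pair (snd _ _))
    have hws : CodeFP (pairE unE clopE) (rawE natE) (fun t => (clopTuple t.2).2.map fun v => v % (t.1 + t.1)) :=
      ((map (g := fun q : (ℕ × ClOp ℕ) × ℕ => q.2 % (q.1.1 + q.1.1)) hm).comp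
        ((CodeFP.id _).pair hT.snd')).congr fun _ => rfl
    exact clop_of_tuple (hT.fst'.pair hws) fun t => AJLCore.BP.clopTuple_map _ _
  exact ((map hop).comp ((CodeFP.id _).pair cubeOpsA_fp)).congr fun _ => rfl


/-! ### The description of the witness circuit -/

/-- The witness circuits are oracle-free. -/
theorem cubeCirc_isOracleFree (n : ℕ) : (cubeCirc n).IsOracleFree := by
  intro g hg
  simp only [cubeCirc, cubeGates] at hg
  split_ifs at hg with hn
  · rw [List.mem_append, List.mem_map] at hg
    rcases hg with ⟨i, -, rfl⟩ | hg
    · trivial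
    · exact revCompile_isOracleFree _ g hg
  · simp at hg

/-- **The witness family is oracle-free.** -/
theorem cubeFamily_isOracleFree : cubeFamily.IsOracleFree := fun n => cubeCirc_isOracleFree n

/-- The abstract gate list of the witness circuit: the Hadamard layer on `0 … n-1` followed by the
abstractly compiled cube program with wires reduced mod `n + n`. -/
theorem map_toAG_cubeGates (n : ℕ) :
    (cubeGates n).map toAG =
      hLayerA (List.range n) ++ progA ((cubeOpsA n).map (ClOp.map fun v => v % (n + n))) := by
  unfold cubeGates
  split_ifs with hn
  · have e1 : (List.finRange n).map (fun i => hOn (Fin.castAdd n i)) =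
        ((List.finRange n).map (Fin.castAdd n)).map hOn := by rw [List.map_map]; rfl
    rw [List.map_append, e1, map_toAG_map_hOn, List.map_map, map_toAG_revCompile_toRevList,
      cubeOpsFin, map_val_map_finOf]
    congr 2
    rw [← List.map_coe_finRange_eq_range (n := n)]
    rfl
  · have h0 : n = 0 := by omega
    subst h0
    rfl

/-- The description of the witness circuit through its abstract gate list. -/
theorem sigmaEncode_cubeCirc (n : ℕ) :
    QCircuit.sigmaEncode (G := cliffordT) ⟨n, n, cubeCirc n⟩ =
      boolPair (encodeNat n) (boolPair (unaryEncodeNat n)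
        (rawE agE (hLayerA (List.range n) ++ progA ((cubeOpsA n).map (ClOp.map fun v => v % (n + n)))))) := by
  rw [QCircuit.sigmaEncode_eq, encode_eq_rawE (cubeCirc n) (cubeCirc_isOracleFree n)]
  simp only [cubeCirc, map_toAG_cubeGates]

/-- The abstract gate list in `FP`. -/
theorem cubeGatesA_fp : CodeFP unE (rawE agE0)
    (fun n => hLayerA (List.range n) ++ progA ((cubeOpsA n).map (ClOp.map fun v => v % (n + n)))) :=
  agAppend (hLayerA_fp.comp urange) (progA_fp.comp cubeOpsMod_fp)

/-- **The description of the witness family in polynomial time.** -/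
theorem desc_codeFP : CodeFP unE (QCircuit.sigmaEncode (G := cliffordT))
    (fun n => (⟨n, cubeFamily.ancillas n, cubeFamily.circ n⟩ : Σ n m : ℕ, QCircuit cliffordT (n + m))) := by
  have hc : CodeFP unE (rawE agE)
      (fun n => hLayerA (List.range n) ++ progA ((cubeOpsA n).map (ClOp.map fun v => v % (n + n)))) :=
    ((map₀ agE_of_agE0).comp cubeGatesA_fp).congr fun _ => List.map_id _
  have h : CodeFP unE (pairE natE (pairE unE (rawE agE)))
      (fun n => (n, n, hLayerA (List.range n) ++ progA ((cubeOpsA n).map (ClOp.map fun v => v % (n + n))))) :=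
    natOfUn.pair ((CodeFP.id _).pair hc)
  exact h.recodeOut fun n => by
    show _ = QCircuit.sigmaEncode (G := cliffordT) ⟨n, n, cubeCirc n⟩
    rw [sigmaEncode_cubeCirc]; rfl

/-- **The witness family is polynomial-time uniform.** -/
theorem cubeFamily_isUniform : cubeFamily.IsUniform := desc_codeFP.polyTimeComputable

end Summit.QuantumAdvantage.QuantumAdvantage.Theorems.SymplecticPurity
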